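import Summits.CriticalPhenomena.SAWScalingLimit.Theorems.SAWDevelopingMapObservableToSLETypeLadderCarvedReductionSqueezeOuterHull
import HarnessLib

/-!
# Crux `SAWDevelopingMap.ObservableToSLE` (stmt-CriticalPhenomena-10472), line `six-class-type-ladder`,
stub T-A′₁ `stub_carvedReduction_confinedOuterHull`: CONFINED JORDAN OUTER APPROXIMANTS OF A
GENERAL `*`-HULL

Landing target:
`Summits/CriticalPhenomena/SAWScalingLimit/Theorems/SAWDevelopingMapObservableToSLETypeLadderCarvedReductionSqueezeConfinedOuterHull.lean`
(`--supports stmt-CriticalPhenomena-10472`; registered sub-goal `stub_carvedReduction_confinedOuterHull`).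

The moving-carving squeeze compares the carved SAW domains with FIXED Jordan outer approximants
`E_n` of the limit carving inside a two-piece flat super-domain `E` with chordal uniformizer
`φ : ℍ → E`; in half-plane coordinates the hull `A = cl(ℍ ∖ φ⁻¹(limit carving))` is a `*`-hull
and `E_n` must SWALLOW a prescribed far part `B ⊆ A`
(`TypeLadder.stub_carvedReduction_outerHull`, the sibling file `…SqueezeOuterHull`).  Since the
reach clause (R) is demanded of the FINAL outer approximant `E_n`, the swallowed part may only
run through a PRESCRIBED open set `W ⊇ B` (the persistently removed zone) plus a thin real box
`{|im| < θ, |re| < Rb + 1}` — never through necks or pockets of the carving.  This file records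
that confined form:

* `stub_carvedReduction_confinedOuterHull` — `stub_carvedReduction_outerHull` with, in addition,
  `φ w ∈ D''` for every `w ∈ ℍ ∖ W` with `θ ≤ im w` or `Rb + 1 ≤ |re w|`.

Proof: the proof of `stub_carvedReduction_outerHull` verbatim (clusters of `B`, thin smooth
hulls around them in separating neighbourhoods `U_C`, swallowed one by one:
`stub_hullApproxDomain_cluster/arcs/multi`), but with the separating neighbourhoods intersected
with the open set `W ∪ {|im| < θ, |re| < Rb + 1}`, which still contains the real fillings
`realFill C = C ∪ [inf (C ∩ ℝ), sup (C ∩ ℝ)]` of the clusters `C ⊆ B ⊆ W ∩ closedBall 0 Rb`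
(`confinedOuterHull_realFill_subset`).  So the smooth hulls, hence the swallowed set `⋃ J_C`,
lie in `W ∪ {|im| < θ, |re| < Rb + 1}`.

Sources: G. F. Lawler, O. Schramm, W. Werner, J. Amer. Math. Soc. 16 (2003) Lemma 2.1 (smooth
hulls are dense); M. H. A. Newman, Elements of the topology of plane sets of points (1939) V §11.
-/

noncomputable section

open scoped Topology NNReal
open Filter Set MeasureTheory Metric Complex Function Bornology
open Literature.Probability.RandomPlanarGeometry
open UpperHalfPlane (upperHalfPlaneSet isOpen_upperHalfPlaneSet)

namespace Summit.CriticalPhenomena.SAWScalingLimit.Theorems.ObservableToSLE.TypeLadder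

open Summit.CriticalPhenomena.SAWScalingLimit.Theorems.ObservableToSLE.FloorRatio
  (stub_hullApproxDomain_cluster stub_hullApproxDomain_arcs stub_hullApproxDomain_multi)

/-- The real trace of a set inside `closedBall 0 Rb` lies in `[-Rb, Rb]`. -/
theorem confinedOuterHull_abs_le_of_mem_realTrace {C : Set ℂ} {Rb : ℝ}
    (hC : C ⊆ closedBall (0 : ℂ) Rb) {x : ℝ} (hx : x ∈ realTrace C) : |x| ≤ Rb := by
  have h : ((x : ℂ)) ∈ closedBall (0 : ℂ) Rb := hC hx
  rwa [mem_closedBall, dist_zero_right, norm_real, Real.norm_eq_abs] at h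

/-- For a set `C ⊆ closedBall 0 Rb` (`0 ≤ Rb`), the real filling interval
`[inf (C ∩ ℝ), sup (C ∩ ℝ)]` lies in `[-Rb, Rb]` (for `C ∩ ℝ = ∅` it is `{0}`, by the junk values
`sInf ∅ = sSup ∅ = 0`). -/
theorem confinedOuterHull_abs_le_of_mem_Icc {C : Set ℂ} {Rb : ℝ} (hRb : 0 ≤ Rb)
    (hC : C ⊆ closedBall (0 : ℂ) Rb) {x : ℝ}
    (hx : x ∈ Icc (sInf (realTrace C)) (sSup (realTrace C))) : |x| ≤ Rb := by
  have hsup : sSup (realTrace C) ≤ Rb :=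
    Real.sSup_le (fun y hy ↦ (abs_le.1 (confinedOuterHull_abs_le_of_mem_realTrace hC hy)).2) hRb
  have hinf : -Rb ≤ sInf (realTrace C) :=
    Real.le_sInf (fun y hy ↦ (abs_le.1 (confinedOuterHull_abs_le_of_mem_realTrace hC hy)).1)
      (by linarith)
  exact abs_le.2 ⟨hinf.trans hx.1, hx.2.trans hsup⟩

/-- **The real filling stays in the confinement zone**: for `C ⊆ W` with `C ⊆ closedBall 0 Rb`
(`0 ≤ Rb`, `0 < θ`), `realFill C ⊆ W ∪ {|im| < θ, |re| < Rb + 1}` (the added points are real with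
modulus `≤ Rb`). -/
theorem confinedOuterHull_realFill_subset {C W : Set ℂ} {Rb θ : ℝ} (hRb : 0 ≤ Rb) (hθ : 0 < θ)
    (hCW : C ⊆ W) (hC : C ⊆ closedBall (0 : ℂ) Rb) :
    realFill C ⊆ W ∪ {z : ℂ | |z.im| < θ ∧ |z.re| < Rb + 1} := by
  rintro z (hz | ⟨x, hx, rfl⟩)
  · exact Or.inl (hCW hz)
  · refine Or.inr ⟨?_, ?_⟩
    · rw [ofReal_im, abs_zero]; exact hθ
    · rw [ofReal_re]; linarith [confinedOuterHull_abs_le_of_mem_Icc hRb hC hx]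

/-- A point outside `W` which is above the box (`θ ≤ im w`) or beside it (`Rb + 1 ≤ |re w|`) is
outside the confinement zone `W ∪ {|im| < θ, |re| < Rb + 1}`. -/
theorem confinedOuterHull_notMem_zone {W : Set ℂ} {Rb θ : ℝ} {w : ℂ} (hwW : w ∉ W)
    (hw : θ ≤ w.im ∨ Rb + 1 ≤ |w.re|) : w ∉ W ∪ {z : ℂ | |z.im| < θ ∧ |z.re| < Rb + 1} := by
  rintro (h | ⟨h1, h2⟩)
  · exact hwW h
  · rcases hw with hw | hw
    · linarith [le_abs_self w.im]
    · linarith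

/-- The confinement zone `W ∪ {|im| < θ, |re| < Rb + 1}` of an open `W` is open. -/
theorem confinedOuterHull_isOpen_zone {W : Set ℂ} (Rb θ : ℝ) (hW : IsOpen W) :
    IsOpen (W ∪ {z : ℂ | |z.im| < θ ∧ |z.re| < Rb + 1}) :=
  hW.union ((isOpen_lt continuous_im.abs continuous_const).and
    (isOpen_lt continuous_re.abs continuous_const))

/-- **Registered sub-goal `stub_carvedReduction_confinedOuterHull`** (crux item
stmt-CriticalPhenomena-10472, line `six-class-type-ladder`, stub T-A′₁; CONFINED OUTER JORDAN
APPROXIMANTS OF A `*`-HULL): let `φ : (ℍ; 0, ∞) → (D; a, b)` be a chordal uniformizing map and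
`A, B ∈ 𝒬*` with every point of `B` at distance `≥ r > 0` from `F = cl(ℍ ∖ A)`, and let
`B ⊆ W ∩ closedBall 0 Rb` with `W` open, `0 ≤ Rb`, `0 < θ`.  Then there is a (Jordan) hull
subdomain `D''` of `D` with `φ w ∈ D''` for every `w ∈ ℍ` with `dist(w, F) ≤ r/4` (in particular
`φ(ℍ ∖ A) ⊆ D''`) AND for every `w ∈ ℍ ∖ W` with `θ ≤ im w` or `Rb + 1 ≤ |re w|` (the swallowed
set is confined to `W ∪ {|im| < θ, |re| < Rb + 1}`), `B ⊆ φ.pullbackHull D'' ⊆ A`, and every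
point of `φ.pullbackHull D''` at distance `≥ r/4` from `F`.  (Proof of
`stub_carvedReduction_outerHull` with the separating neighbourhoods of the clusters intersected
with the confinement zone, which contains their real fillings.)
[cite: LawlerSchrammWerner2003Restriction, Lemma 2.1] -/
theorem stub_carvedReduction_confinedOuterHull :
    (∀ (D : DobrushinDomain) (φ : ConformalEquiv upperHalfPlaneSet D.carrier) (A B W : Set ℂ) (r Rb θ : ℝ),
      D.IsChordalUniformizing φ → IsStarHull A → IsStarHull B → 0 < r → 0 ≤ Rb → 0 < θ →
      (∀ w ∈ B, r ≤ infDist w (closure (upperHalfPlaneSet \ A))) →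
      IsOpen W → B ⊆ W → B ⊆ closedBall 0 Rb →
      ∃ D'' : DobrushinDomain, D.IsHullSubdomain D'' ∧
        (∀ w ∈ upperHalfPlaneSet, infDist w (closure (upperHalfPlaneSet \ A)) ≤ r / 4 → φ w ∈ D''.carrier) ∧
        (∀ w ∈ upperHalfPlaneSet, w ∉ W → (θ ≤ w.im ∨ Rb + 1 ≤ |w.re|) → φ w ∈ D''.carrier) ∧
        B ⊆ φ.pullbackHull D'' ∧ φ.pullbackHull D'' ⊆ A ∧
        (∀ w ∈ φ.pullbackHull D'', r / 4 ≤ infDist w (closure (upperHalfPlaneSet \ A)))) := by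
  intro D φ A B W r Rb θ hφ hA hB hr hRb hθ hfar hW hBW hBR
  classical
  set F : Set ℂ := closure (upperHalfPlaneSet \ A) with hFdef
  -- the confinement zone
  set T : Set ℂ := W ∪ {z : ℂ | |z.im| < θ ∧ |z.re| < Rb + 1} with hTdef
  have hTo : IsOpen T := confinedOuterHull_isOpen_zone Rb θ hW
  have hnotT : ∀ {w : ℂ}, w ∉ W → (θ ≤ w.im ∨ Rb + 1 ≤ |w.re|) → w ∉ T := fun hwW hw ↦
    confinedOuterHull_notMem_zone hwW hw
  -- the pulled-back hull of a hull subdomain, in terms of its carrier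
  have hpull : ∀ (D'' : DobrushinDomain),
      φ.pullbackHull D'' = closure (upperHalfPlaneSet \ φ.pullbackDomain D'') := fun D'' ↦ rfl
  -- the empty hull: take `D'' = D`
  rcases B.eq_empty_or_nonempty with rfl | hBne
  · have hdom : φ.pullbackDomain D = upperHalfPlaneSet := by
      ext z
      exact ⟨fun hz ↦ hz.1, fun hz ↦ ⟨hz, φ.mapsTo hz⟩⟩
    have hhull : φ.pullbackHull D = ∅ := by
      rw [hpull, hdom, sdiff_self]; exact closure_empty
    refine ⟨D, MarkedDomain.isHullSubdomain_self D, fun w hw _ ↦ φ.mapsTo hw,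
      fun w hw _ _ ↦ φ.mapsTo hw, empty_subset _, ?_, ?_⟩
    · rw [hhull]; exact empty_subset _
    · rw [hhull]; intro w hw; exact hw.elim
  -- clusters
  obtain ⟨S, hS, hBS, hpair⟩ := stub_hullApproxDomain_cluster A B r hA hB hBne hr hfar
  -- separating neighbourhoods of the real fillings, CONFINED to the zone `T`
  set U : Set ℂ → Set ℂ := fun C ↦
    ((⋂ C' ∈ S.erase C, {w | infDist w (realFill C) < infDist w (realFill C')}) ∩
      {w | r / 4 < infDist w F}) ∩ T with hU
  have hUo : ∀ C, IsOpen (U C) := fun C ↦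
    ((isOpen_biInter_finset fun C' _ ↦
      isOpen_lt (continuous_infDist_pt _) (continuous_infDist_pt _)).inter
      (isOpen_lt continuous_const (continuous_infDist_pt _))).inter hTo
  have hRc : ∀ C ∈ S, IsClosed (realFill C) := fun C hC ↦ by
    have h := (hS C hC).1
    have hb : IsBoundedHull C := h.elim (fun h ↦ h.1.isBoundedHull) (fun h ↦ h.1.isBoundedHull)
    exact hb.isClosed.union ((isCompact_Icc.image Complex.continuous_ofReal).isClosed)
  -- the real fillings of the clusters lie in the zone: `C ⊆ B ⊆ W ∩ closedBall 0 Rb`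
  have hRT : ∀ C ∈ S, realFill C ⊆ T := fun C hC ↦
    confinedOuterHull_realFill_subset hRb hθ ((hS C hC).2.2.1.trans hBW)
      ((hS C hC).2.2.1.trans hBR)
  have hRU : ∀ C ∈ S, realFill C ⊆ U C := by
    intro C hC w hw
    refine ⟨⟨mem_iInter₂.2 fun C' hC' ↦ ?_,
      lt_of_lt_of_le (by linarith : r / 4 < r / 2) ((hS C hC).2.2.2 w hw)⟩, hRT C hC hw⟩
    obtain ⟨hne, hC'S⟩ := Finset.mem_erase.1 hC'
    have hdisj : Disjoint (realFill C) (realFill C') :=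
      hpair (Finset.mem_coe.2 hC) (Finset.mem_coe.2 hC'S) (Ne.symm hne)
    have hw' : w ∉ realFill C' := fun h ↦ Set.disjoint_left.1 hdisj hw h
    have hne' : (realFill C').Nonempty := (hS C' hC'S).2.1.mono (subset_realFill C')
    show infDist w (realFill C) < infDist w (realFill C')
    rw [infDist_zero_of_mem hw]
    exact ((hRc C' hC'S).notMem_iff_infDist_pos hne').1 hw'
  have hUdisj : ∀ C ∈ S, ∀ C' ∈ S, C ≠ C' → Disjoint (U C) (U C') := by
    intro C hC C' hC' hne
    refine Set.disjoint_left.2 fun w hw hw' ↦ ?_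
    have h1 : infDist w (realFill C) < infDist w (realFill C') :=
      mem_iInter₂.1 hw.1.1 C' (Finset.mem_erase.2 ⟨Ne.symm hne, hC'⟩)
    have h2 : infDist w (realFill C') < infDist w (realFill C) :=
      mem_iInter₂.1 hw'.1.1 C (Finset.mem_erase.2 ⟨hne, hC⟩)
    linarith
  -- thin smooth hulls around the clusters
  have harc : ∀ C ∈ S, ∃ J : Set ℂ, IsArcHull J ∧ (0 : ℂ) ∉ J ∧ C ⊆ J ∧ J ⊆ U C := fun C hC ↦
    stub_hullApproxDomain_arcs C (U C) (hS C hC).1 (hS C hC).2.1 (hUo C) (hRU C hC)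
  choose! J hJa hJ0 hCJ hJU using harc
  set SJ : Finset (Set ℂ) := S.image J with hSJ
  have hSJmem : ∀ {J' : Set ℂ}, J' ∈ SJ ↔ ∃ C ∈ S, J C = J' := by
    intro J'; rw [hSJ, Finset.mem_image]
  have hSJarc : ∀ J' ∈ SJ, IsArcHull J' ∧ (0 : ℂ) ∉ J' := by
    intro J' hJ'
    obtain ⟨C, hC, rfl⟩ := hSJmem.1 hJ'
    exact ⟨hJa C hC, hJ0 C hC⟩
  have hSJpair : (SJ : Set (Set ℂ)).Pairwise Disjoint := by
    intro J₁ hJ₁ J₂ hJ₂ hne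
    obtain ⟨C₁, hC₁, rfl⟩ := hSJmem.1 (Finset.mem_coe.1 hJ₁)
    obtain ⟨C₂, hC₂, rfl⟩ := hSJmem.1 (Finset.mem_coe.1 hJ₂)
    have hC : C₁ ≠ C₂ := fun h ↦ hne (by rw [h])
    exact (hUdisj C₁ hC₁ C₂ hC₂ hC).mono (hJU C₁ hC₁) (hJU C₂ hC₂)
  -- points of the smooth hulls are far from `F` …
  have hJfar : ∀ {w : ℂ}, w ∈ ⋃₀ (SJ : Set (Set ℂ)) → r / 4 < infDist w F := by
    rintro w ⟨J', hJ', hw⟩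
    obtain ⟨C, hC, rfl⟩ := hSJmem.1 (Finset.mem_coe.1 hJ')
    exact (hJU C hC hw).1.2
  -- … and lie in the confinement zone
  have hJT : ∀ {w : ℂ}, w ∈ ⋃₀ (SJ : Set (Set ℂ)) → w ∈ T := by
    rintro w ⟨J', hJ', hw⟩
    obtain ⟨C, hC, rfl⟩ := hSJmem.1 (Finset.mem_coe.1 hJ')
    exact (hJU C hC hw).2
  -- swallow the smooth hulls
  obtain ⟨D'', hD'', hcar⟩ := stub_hullApproxDomain_multi D φ SJ hφ hSJarc hSJpair
  -- the new hull is `cl(⋃ J ∩ ℍ)`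
  have hdom : φ.pullbackDomain D'' = upperHalfPlaneSet \ ⋃₀ (SJ : Set (Set ℂ)) := by
    ext z
    constructor
    · rintro ⟨hz, hzD⟩
      refine ⟨hz, fun hzJ ↦ ?_⟩
      rw [hcar] at hzD
      obtain ⟨z', hz', hzz'⟩ := hzD
      have : z' = z := φ.injOn hz'.1 hz hzz'
      exact hz'.2 (this ▸ hzJ)
    · rintro ⟨hz, hzJ⟩
      refine ⟨hz, ?_⟩
      rw [hcar]
      exact ⟨z, ⟨hz, hzJ⟩, rfl⟩
  have hhull : φ.pullbackHull D'' = closure (⋃₀ (SJ : Set (Set ℂ)) ∩ upperHalfPlaneSet) := by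
    rw [hpull, hdom]
    congr 1
    ext z
    simp only [Set.mem_sdiff, mem_inter_iff, not_and, not_not]
    tauto
  have hfarJ : ∀ w ∈ φ.pullbackHull D'', r / 4 ≤ infDist w F := by
    rw [hhull]
    intro w hw
    have hcont : Continuous fun w ↦ infDist w F := continuous_infDist_pt F
    exact closure_minimal (fun w hw ↦ (le_of_lt (hJfar hw.1) : r / 4 ≤ infDist w F))
      (isClosed_le continuous_const hcont) hw
  refine ⟨D'', hD'', ?_, ?_, ?_, ?_, hfarJ⟩
  · -- the collar `dist(w, F) ≤ r/4` is swallowed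
    intro w hw hwr
    have hwJ : w ∉ ⋃₀ (SJ : Set (Set ℂ)) := fun h ↦ by linarith [hJfar h]
    rw [hcar]
    exact ⟨w, ⟨hw, hwJ⟩, rfl⟩
  · -- CONFINEMENT: points of `ℍ ∖ W` above or beside the box are swallowed
    intro w hw hwW hwfar
    have hwJ : w ∉ ⋃₀ (SJ : Set (Set ℂ)) := fun h ↦ hnotT hwW hwfar (hJT h)
    rw [hcar]
    exact ⟨w, ⟨hw, hwJ⟩, rfl⟩
  · -- `B ⊆ φ.pullbackHull D''`
    have hsub : B ∩ upperHalfPlaneSet ⊆ ⋃₀ (SJ : Set (Set ℂ)) ∩ upperHalfPlaneSet := by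
      rintro b ⟨hbB, hbH⟩
      obtain ⟨C, hC, hbC⟩ := hBS hbB
      exact ⟨⟨J C, Finset.mem_coe.2 (hSJmem.2 ⟨C, Finset.mem_coe.1 hC, rfl⟩), hCJ C hC hbC⟩, hbH⟩
    rw [← hB.isBoundedHull.closure_inter_eq, hhull]
    exact closure_mono hsub
  · -- `φ.pullbackHull D'' ⊆ A`
    intro w hw
    -- `w ∈ cl(⋃ J ∩ ℍ)`; approximate by points of `ℍ` far from `F`, which lie in `A`
    rw [hhull] at hw
    refine hA.isBoundedHull.isClosed.closure_subset_iff.2 (fun z hz ↦ ?_) hw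
    exact mem_of_infDist_pos hz.2 (lt_of_lt_of_le (by positivity) (le_of_lt (hJfar hz.1)))

end Summit.CriticalPhenomena.SAWScalingLimit.Theorems.ObservableToSLE.TypeLadder

end
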